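import Literature.Analysis.FluidPDE.TorusLinearisedNSShearParallel
import HarnessLib

/-!
# The linearised Navier–Stokes flow at a streamwise-invariant background commutes with streamwise
# translations: linearity, translation covariance, and the invariance of the streamwise isotypic
# (Fourier-mode) relations

Analysis/FluidPDE proof file (theorems only; no definitions, no named facts), sequel of
`TorusLinearisedNSShearParallel` (the streamwise mode `k = 0`: parallel invariant data evolve by the
heat equation). Here the general MODE-BY-MODE DECOUPLING behind every linear stability analysis of
shear flows (normal modes `e^{ikx} φ(y, t)`: Drazin 2002 §8.1 (8.9)–(8.11); Bedrossian–Coti Zelati 2017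
§1, "`P_k` denotes the projection to the `k`-th Fourier mode in `x`") is recorded in the kernel's
classical vocabulary, for the Navier–Stokes equations linearised at a background `u` on `[a, b] × 𝕋^d`
that is INVARIANT under the translations along the `i`-th axis (`u(t, x + s eᵢ) = u(t, x)`; no
parallelism needed), `∂ₜw + (u·∇)w + (w·∇)u = νΔw − ∇q`, `div w = 0` (Temam 1997, Ch. VI §3.1
(3.7)–(3.11), unbundled as in `FunctionSpaces/TorusLinearisedNSEnergy`):

* `Torus.linearisedNS_const_smul`, `Torus.linearisedNS_sub` — linearity of the classical solution
  class (with `Torus.linearisedNS_sub_eq` of the tree);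
* `Torus.linearisedNS_comp_add_right_space` — TRANSLATION COVARIANCE: if `u` is invariant under
  `x ↦ x + v` then `(w(·, · + v), q(·, · + v))` is again a classical solution;
* `Torus.linearisedNS_streamwise_rotation_invariant` — the ISOTYPIC RELATIONS ARE PRESERVED: if two
  classical solutions `(w¹, q¹)`, `(w², q²)` along `u` have data satisfying, for a translation
  `v = s eᵢ` and an angle `α`, the rotation relation
  `w¹(a, x + v) = cos α · w¹(a, x) − sin α · w²(a, x)`, `w²(a, x + v) = sin α · w¹(a, x) + cos α · w²(a, x)`
  (e.g. `w¹ + i w² = e^{2πi l xᵢ} Φ(x')` with `α = 2π l s`: a single streamwise Fourier mode and its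
  quadrature companion), then the same relation holds at every `t ∈ [a, b]` — by covariance,
  linearity and `Torus.linearisedNS_unique`. With `α = 0` this is plain invariance
  (`Torus.linearisedNS_translate_invariant`, `Torus.linearisedNS_forall_add_single_invariant`:
  streamwise-invariant data stay streamwise invariant, the `k = 0` block), complementing the parallel
  case of `TorusLinearisedNSShearParallel`. (The Fourier-side reading — coefficients supported on the
  streamwise lines `kᵢ ∈ {±l}` — follows from the rotation relation by the tree's
  `mFourierCoeff_eq_zero_of_forall_add_single_eq_fourier_mul` (`PassiveScalarShearFibreDamping`); it is
  not restated here to keep the import cone small.)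

For the cell `ad-ideate` (route `SawtoothPulseCascade`, crux K2″ = item 19696 in classical typing,
`K2PhaseGrowthClassical`): on each half-slot the cascade carrier is streamwise invariant, so the
Kelvin–Helmholtz / Orr response of a comb datum splits into independent streamwise modes, each a
one-dimensional (cross-stream) linear problem — the Orr–Sommerfeld initial-value problem of that mode.

## Mathlib / tree search

Tree (reused): `Torus.linearisedNS_unique`, `Torus.linearisedNS_sub_eq`
(`FunctionSpaces/TorusLinearisedNSEnergy`), `Torus.fderiv_const_smul`, `Torus.fderiv_sub`,
`Torus.gradient_sub`, `Torus.laplacian_sub`, `Torus.partialDeriv_const_smul`,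
`Torus.gradient_eq_sum_partialDeriv`, `Torus.laplacian_eq_sum_partialDeriv_partialDeriv`, and the
space-translation lemmas of `TorusLinearisedNSShearParallel`. Searched
`linearisedNS.*comp_add|linearisedNS.*smul|streamwise.*invariant` (`lean search`): nothing beyond the
time translation `linearisedNS_comp_add_const` (`TorusLinearisedNSGlobalExistence`).

## References

* P. G. Drazin, *Introduction to Hydrodynamic Stability* (2002), §8.1 (8.9)–(8.11) (normal modes
  `e^{ik(x−ct)}φ(z)` of the linearised problem at a parallel flow; held:
  `book:drazin2002-introduction-hydrodynamic-stability`). [`Drazin2002`]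
* J. Bedrossian, M. Coti Zelati, ARMA 224 (2017), §1 Thm 1.1 (`P_k`, the `k`-th streamwise mode; held:
  `paper:arxiv-1510.08098`, p. 3). [`BedrossianCotiZelati2017`]
* R. Temam, *Infinite-Dimensional Dynamical Systems in Mechanics and Physics* (1997), Ch. VI §3.1
  (3.7)–(3.11). [`Temam1997`]
-/

noncomputable section

open MeasureTheory Set Filter Function
open scoped ContDiff InnerProductSpace RealInnerProductSpace Topology

namespace Literature.Analysis.FluidPDE

open Literature.Analysis.FunctionSpaces

variable {d : Type*} [Fintype d] [DecidableEq d]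

/-! ### Calculus: constant multiples and space translates -/

section Calculus

variable {F : Type*} [NormedAddCommGroup F] [NormedSpace ℝ F]

/-- `Δ(c f) = c Δf` for smooth `f` (`Δ = ∑ᵢ ∂ᵢ∂ᵢ` and `∂ᵢ(c f) = c ∂ᵢf`).
[cite: Evans2010, App. A.3 (Δu = ∑ u_{x_i x_i}; linearity)] -/
theorem Torus.laplacian_const_smul_of_isSmooth {f : UnitAddTorus d → F} (hf : Torus.IsSmooth f) (c : ℝ)
    (x : UnitAddTorus d) : Torus.laplacian (c • f) x = c • Torus.laplacian f x := by
  rw [Torus.laplacian_eq_sum_partialDeriv_partialDeriv (hf.smul c),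
    Torus.laplacian_eq_sum_partialDeriv_partialDeriv hf, Finset.smul_sum]
  refine Finset.sum_congr rfl fun j _ => ?_
  have h1 : Torus.partialDeriv j (c • f) = c • Torus.partialDeriv j f := by
    funext y
    rw [Torus.partialDeriv_const_smul (hf.isContDiff (by simp)) c j]
  rw [h1, Torus.partialDeriv_const_smul ((hf.partialDeriv j).isContDiff (by simp)) c j]
  rfl

omit [DecidableEq d] in
/-- `∇(c q) = c ∇q` for `C¹` scalar `q`. [cite: Evans2010, App. A.3 (Du; linearity)] -/
theorem Torus.gradient_const_smul_of_isContDiff {q : UnitAddTorus d → ℝ} (hq : Torus.IsContDiff 1 q) (c : ℝ)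
    (x : UnitAddTorus d) : Torus.gradient (c • q) x = c • Torus.gradient q x := by
  classical
  rw [Torus.gradient_eq_sum_partialDeriv (hq.smul c), Torus.gradient_eq_sum_partialDeriv hq, Finset.smul_sum]
  refine Finset.sum_congr rfl fun j _ => ?_
  rw [Torus.partialDeriv_const_smul hq c j, Pi.smul_apply, smul_eq_mul, mul_smul]

omit [Fintype d] [DecidableEq d] in
/-- The torus derivative commutes with space translation: `D(f(· + v))(x) = (Df)(x + v)` (the
re-centred lifts agree). [cite: Evans2010, App. A.3 (Du; translation invariance)] -/
theorem Torus.fderiv_comp_add_right (f : UnitAddTorus d → F) (v x : UnitAddTorus d) :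
    Torus.fderiv (fun y => f (y + v)) x = Torus.fderiv f (x + v) := by
  have h : Torus.liftAt (fun y => f (y + v)) x = Torus.liftAt f (x + v) := by
    funext w
    simp only [Torus.liftAt_apply, add_right_comm]
  simp only [Torus.fderiv, h]

omit [DecidableEq d] in
/-- `Δ(f(· + v))(x) = (Δf)(x + v)` (private copy of `Torus.laplacian_comp_add_right`, light imports). [folklore] -/
private theorem laplacian_comp_add_right'' (f : UnitAddTorus d → F) (v x : UnitAddTorus d) :
    Torus.laplacian (fun y => f (y + v)) x = Torus.laplacian f (x + v) := by
  have h : Torus.liftAt (fun y => f (y + v)) x = Torus.liftAt f (x + v) := by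
    funext w
    simp only [Torus.liftAt_apply, add_right_comm]
  simp only [Torus.laplacian, h]

omit [DecidableEq d] in
/-- `∇(θ(· + v))(x) = (∇θ)(x + v)` (private copy of `Torus.gradient_comp_add_right`, light imports). [folklore] -/
private theorem gradient_comp_add_right'' (θ : UnitAddTorus d → ℝ) (v x : UnitAddTorus d) :
    Torus.gradient (fun y => θ (y + v)) x = Torus.gradient θ (x + v) := by
  have h : Torus.liftAt (fun y => θ (y + v)) x = Torus.liftAt θ (x + v) := by
    funext w
    simp only [Torus.liftAt_apply, add_right_comm]
  simp only [Torus.gradient, h]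

/-- `div (c f) = c div f` for a smooth vector field `f`. [cite: Evans2010, App. A.3 (div; linearity)] -/
theorem Torus.divergence_const_smul_of_isSmooth {f : UnitAddTorus d → EuclideanSpace ℝ d} (hf : Torus.IsSmooth f)
    (c : ℝ) (x : UnitAddTorus d) : Torus.divergence (c • f) x = c * Torus.divergence f x := by
  unfold Torus.divergence
  rw [Finset.mul_sum]
  refine Finset.sum_congr rfl fun j _ => ?_
  have hcomp : (fun y => (c • f) y j) = c • fun y => f y j := by
    funext y; simp [Pi.smul_apply, smul_eq_mul]
  rw [hcomp, Torus.partialDeriv_const_smul ((hf.apply j).isContDiff (by simp)) c j]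
  simp [smul_eq_mul]

omit [DecidableEq d] in
/-- `div (f(· + v))(x) = (div f)(x + v)`. [cite: Evans2010, App. A.3 (div; translation invariance)] -/
theorem Torus.divergence_comp_add_right [DecidableEq d] (f : UnitAddTorus d → EuclideanSpace ℝ d)
    (v x : UnitAddTorus d) :
    Torus.divergence (fun y => f (y + v)) x = Torus.divergence f (x + v) := by
  simp only [Torus.divergence, Torus.partialDeriv, Torus.lineDeriv, add_right_comm]

end Calculus

/-! ### Linearity and translation covariance of the classical linearised solution class -/

section Linear

variable {a b ν : ℝ} {u w w₁ w₂ : ℝ → UnitAddTorus d → EuclideanSpace ℝ d} {q q₁ q₂ : ℝ → UnitAddTorus d → ℝ}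

/-- **Constant multiples.** If `(w, q)` is a classical solution of the linearised Navier–Stokes system
along `u` on `[a, b]` then so is `(c w, c q)`. [cite: Temam1997, Ch. VI §3.1 (3.7)-(3.10) (a linear problem)] -/
theorem Torus.linearisedNS_const_smul (hab : a < b)
    (hw : Torus.IsSmoothSpaceTimeOn (Icc a b) w) (hq : Torus.IsSmoothSpaceTimeOn (Icc a b) q)
    (hlin : ∀ t ∈ Icc a b, ∀ x, Torus.timeDerivWithin (Icc a b) w t x + Torus.convect (u t) (w t) x +
      Torus.convect (w t) (u t) x = ν • Torus.laplacian (w t) x - Torus.gradient (q t) x)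
    (c : ℝ) {t : ℝ} (ht : t ∈ Icc a b) (x : UnitAddTorus d) :
    Torus.timeDerivWithin (Icc a b) (fun s y => c • w s y) t x + Torus.convect (u t) (fun y => c • w t y) x +
        Torus.convect (fun y => c • w t y) (u t) x =
      ν • Torus.laplacian (fun y => c • w t y) x - Torus.gradient (fun y => c • q t y) x := by
  have hwt : Torus.IsSmooth (w t) := hw.isSmooth_slice ht
  have hqt : Torus.IsContDiff 1 (q t) := (hq.isSmooth_slice ht).isContDiff (by simp)
  have hD : Torus.timeDerivWithin (Icc a b) (fun s y => c • w s y) t x =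
      c • Torus.timeDerivWithin (Icc a b) w t x :=
    ((hw.hasDerivWithinAt_slice ht x).const_smul c).derivWithin (uniqueDiffOn_Icc hab t ht)
  have hwc : (fun y => c • w t y) = c • w t := rfl
  have hqc : (fun y => c • q t y) = c • q t := rfl
  have hA : Torus.convect (u t) (fun y => c • w t y) x = c • Torus.convect (u t) (w t) x := by
    rw [hwc, Torus.convect, Torus.fderiv_const_smul (hwt.isContDiff (by simp)) c, smul_apply, Torus.convect]
  have hB : Torus.convect (fun y => c • w t y) (u t) x = c • Torus.convect (w t) (u t) x := by
    simp only [Torus.convect, map_smul]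
  have hL : Torus.laplacian (fun y => c • w t y) x = c • Torus.laplacian (w t) x := by
    rw [hwc, Torus.laplacian_const_smul_of_isSmooth hwt c x]
  have hG : Torus.gradient (fun y => c • q t y) x = c • Torus.gradient (q t) x := by
    rw [hqc, Torus.gradient_const_smul_of_isContDiff hqt c x]
  rw [hD, hA, hB, hL, hG, ← smul_add, ← smul_add, hlin t ht x, smul_sub, smul_comm]

/-- **Differences.** If `(w₁, q₁)` and `(w₂, q₂)` are classical solutions of the linearised system along `u`
on `[a, b]` then so is `(w₁ − w₂, q₁ − q₂)` (the tree's `Torus.linearisedNS_sub_eq`, restated in the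
`fun`-form used here). [cite: Temam1997, Ch. VI §3.1 (3.7)-(3.10) (a linear problem)] -/
theorem Torus.linearisedNS_sub (hab : a < b)
    (hw₁ : Torus.IsSmoothSpaceTimeOn (Icc a b) w₁) (hq₁ : Torus.IsSmoothSpaceTimeOn (Icc a b) q₁)
    (hlin₁ : ∀ t ∈ Icc a b, ∀ x, Torus.timeDerivWithin (Icc a b) w₁ t x + Torus.convect (u t) (w₁ t) x +
      Torus.convect (w₁ t) (u t) x = ν • Torus.laplacian (w₁ t) x - Torus.gradient (q₁ t) x)
    (hw₂ : Torus.IsSmoothSpaceTimeOn (Icc a b) w₂) (hq₂ : Torus.IsSmoothSpaceTimeOn (Icc a b) q₂)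
    (hlin₂ : ∀ t ∈ Icc a b, ∀ x, Torus.timeDerivWithin (Icc a b) w₂ t x + Torus.convect (u t) (w₂ t) x +
      Torus.convect (w₂ t) (u t) x = ν • Torus.laplacian (w₂ t) x - Torus.gradient (q₂ t) x)
    {t : ℝ} (ht : t ∈ Icc a b) (x : UnitAddTorus d) :
    Torus.timeDerivWithin (Icc a b) (fun s y => w₁ s y - w₂ s y) t x +
        Torus.convect (u t) (fun y => w₁ t y - w₂ t y) x + Torus.convect (fun y => w₁ t y - w₂ t y) (u t) x =
      ν • Torus.laplacian (fun y => w₁ t y - w₂ t y) x - Torus.gradient (fun y => q₁ t y - q₂ t y) x :=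
  Torus.linearisedNS_sub_eq hw₁ hq₁ hlin₁ hw₂ hq₂ hlin₂ hab ht x

omit [DecidableEq d] in
/-- **Translation covariance.** If the background `u` is invariant under the space translation
`x ↦ x + v` on `[a, b]` and `(w, q)` is a classical solution of the linearised system along `u`, then
so is the translate `(w(·, · + v), q(·, · + v))` (every term of the equation commutes with the
translation; the background is unchanged). [cite: Drazin2002, §8.1 (8.9)-(8.11) (homogeneity in x of the linearised problem at a parallel flow)] -/
theorem Torus.linearisedNS_comp_add_right_space
    (hlin : ∀ t ∈ Icc a b, ∀ x, Torus.timeDerivWithin (Icc a b) w t x + Torus.convect (u t) (w t) x +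
      Torus.convect (w t) (u t) x = ν • Torus.laplacian (w t) x - Torus.gradient (q t) x)
    (v : UnitAddTorus d) (huv : ∀ t ∈ Icc a b, ∀ x, u t (x + v) = u t x)
    {t : ℝ} (ht : t ∈ Icc a b) (x : UnitAddTorus d) :
    Torus.timeDerivWithin (Icc a b) (fun s y => w s (y + v)) t x + Torus.convect (u t) (fun y => w t (y + v)) x +
        Torus.convect (fun y => w t (y + v)) (u t) x =
      ν • Torus.laplacian (fun y => w t (y + v)) x - Torus.gradient (fun y => q t (y + v)) x := by
  have hufun : u t = fun y => u t (y + v) := funext fun y => (huv t ht y).symm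
  have hA : Torus.convect (u t) (fun y => w t (y + v)) x = Torus.convect (u t) (w t) (x + v) := by
    rw [Torus.convect, Torus.convect, Torus.fderiv_comp_add_right, ← huv t ht x]
  have hB : Torus.convect (fun y => w t (y + v)) (u t) x = Torus.convect (w t) (u t) (x + v) := by
    rw [Torus.convect, Torus.convect]
    conv_lhs => rw [hufun, Torus.fderiv_comp_add_right]
  rw [Torus.timeDerivWithin_comp_add_right_space, hA, hB, laplacian_comp_add_right'',
    gradient_comp_add_right'']
  exact hlin t ht (x + v)

/-- Divergence-freeness is preserved by space translation. [cite: Evans2010, App. A.3 (div; translation invariance)] -/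
theorem Torus.isDivFree_comp_add_right {f : UnitAddTorus d → EuclideanSpace ℝ d} (hf : Torus.IsDivFree f)
    (v : UnitAddTorus d) : Torus.IsDivFree (fun y => f (y + v)) := fun x => by
  rw [Torus.divergence_comp_add_right]; exact hf (x + v)

end Linear

/-! ### Invariance of the streamwise isotypic relations -/

section Modes

variable {a b ν : ℝ} {u w₁ w₂ : ℝ → UnitAddTorus d → EuclideanSpace ℝ d} {q₁ q₂ : ℝ → UnitAddTorus d → ℝ}

/-- **The linearised flow preserves the streamwise rotation (isotypic) relations.** Let `u` be a jointly
smooth divergence-free background on `[a, b] × 𝕋^d`, invariant under the space translation `x ↦ x + v`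
(`ν ≥ 0`), and let `(w₁, q₁)`, `(w₂, q₂)` be classical solutions of the linearised Navier–Stokes system
along `u`. If at `t = a` the data satisfy, for an angle `α`, the rotation relation under translation by
`v`: `w₁(a, x + v) = cos α · w₁(a, x) − sin α · w₂(a, x)` and
`w₂(a, x + v) = sin α · w₁(a, x) + cos α · w₂(a, x)` for all `x` — e.g. `w₁ + i w₂ = e^{2πilxᵢ}Φ(x')`,
`v = s eᵢ`, `α = 2πls`: ONE streamwise normal mode and its quadrature companion (Drazin 2002 §8.1
(8.11)) — then the same two identities hold at every `t ∈ [a, b]`: translation covariance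
(`Torus.linearisedNS_comp_add_right_space`), linearity and uniqueness (`Torus.linearisedNS_unique`).
[cite: Drazin2002, §8.1 (8.9)-(8.11) (normal modes of the linearised problem at a parallel flow)] [cite: BedrossianCotiZelati2017, §1 Thm 1.1 (P_k, the k-th streamwise Fourier mode decouples)] -/
theorem Torus.linearisedNS_streamwise_rotation_invariant (hν : 0 ≤ ν) (hab : a < b)
    (hu : Torus.IsSmoothSpaceTimeOn (Icc a b) u) (hudiv : ∀ t ∈ Icc a b, Torus.IsDivFree (u t))
    (v : UnitAddTorus d) (huv : ∀ t ∈ Icc a b, ∀ x, u t (x + v) = u t x)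
    (hw₁ : Torus.IsSmoothSpaceTimeOn (Icc a b) w₁) (hq₁ : Torus.IsSmoothSpaceTimeOn (Icc a b) q₁)
    (hwdiv₁ : ∀ t ∈ Icc a b, Torus.IsDivFree (w₁ t))
    (hlin₁ : ∀ t ∈ Icc a b, ∀ x, Torus.timeDerivWithin (Icc a b) w₁ t x + Torus.convect (u t) (w₁ t) x +
      Torus.convect (w₁ t) (u t) x = ν • Torus.laplacian (w₁ t) x - Torus.gradient (q₁ t) x)
    (hw₂ : Torus.IsSmoothSpaceTimeOn (Icc a b) w₂) (hq₂ : Torus.IsSmoothSpaceTimeOn (Icc a b) q₂)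
    (hwdiv₂ : ∀ t ∈ Icc a b, Torus.IsDivFree (w₂ t))
    (hlin₂ : ∀ t ∈ Icc a b, ∀ x, Torus.timeDerivWithin (Icc a b) w₂ t x + Torus.convect (u t) (w₂ t) x +
      Torus.convect (w₂ t) (u t) x = ν • Torus.laplacian (w₂ t) x - Torus.gradient (q₂ t) x)
    (α : ℝ)
    (h₁ : ∀ x, w₁ a (x + v) = Real.cos α • w₁ a x - Real.sin α • w₂ a x)
    (h₂ : ∀ x, w₂ a (x + v) = Real.sin α • w₁ a x + Real.cos α • w₂ a x)
    {t : ℝ} (ht : t ∈ Icc a b) (x : UnitAddTorus d) :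
    w₁ t (x + v) = Real.cos α • w₁ t x - Real.sin α • w₂ t x ∧
      w₂ t (x + v) = Real.sin α • w₁ t x + Real.cos α • w₂ t x := by
  -- the translates are solutions
  have hT₁ := fun s hs y => Torus.linearisedNS_comp_add_right_space hlin₁ v huv (t := s) hs y
  have hT₂ := fun s hs y => Torus.linearisedNS_comp_add_right_space hlin₂ v huv (t := s) hs y
  have hTs₁ := hw₁.comp_add_right_space v
  have hTs₂ := hw₂.comp_add_right_space v
  have hTq₁ := hq₁.comp_add_right_space v
  have hTq₂ := hq₂.comp_add_right_space v
  have hTdiv₁ : ∀ s ∈ Icc a b, Torus.IsDivFree (fun y => w₁ s (y + v)) := fun s hs =>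
    Torus.isDivFree_comp_add_right (hwdiv₁ s hs) v
  have hTdiv₂ : ∀ s ∈ Icc a b, Torus.IsDivFree (fun y => w₂ s (y + v)) := fun s hs =>
    Torus.isDivFree_comp_add_right (hwdiv₂ s hs) v
  -- the rotated combinations are solutions: R₁ = cos α • w₁ − sin α • w₂, R₂ = sin α • w₁ + cos α • w₂
  have hc₁ := fun s hs y => Torus.linearisedNS_const_smul hab hw₁ hq₁ hlin₁ (Real.cos α) (t := s) hs y
  have hs₂ := fun s hs y => Torus.linearisedNS_const_smul hab hw₂ hq₂ hlin₂ (Real.sin α) (t := s) hs y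
  have hs₁ := fun s hs y => Torus.linearisedNS_const_smul hab hw₁ hq₁ hlin₁ (Real.sin α) (t := s) hs y
  have hc₂ := fun s hs y => Torus.linearisedNS_const_smul hab hw₂ hq₂ hlin₂ (-Real.cos α) (t := s) hs y
  have hR₁ := fun s hs y => Torus.linearisedNS_sub hab (hw₁.const_smul _) (hq₁.const_smul _) hc₁
    (hw₂.const_smul _) (hq₂.const_smul _) hs₂ (t := s) hs y
  have hR₂ := fun s hs y => Torus.linearisedNS_sub hab (hw₁.const_smul _) (hq₁.const_smul _) hs₁
    (hw₂.const_smul _) (hq₂.const_smul _) hc₂ (t := s) hs y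
  have hRs₁ : Torus.IsSmoothSpaceTimeOn (Icc a b) (fun s y => Real.cos α • w₁ s y - Real.sin α • w₂ s y) :=
    (hw₁.const_smul _).sub (hw₂.const_smul _)
  have hRs₂ : Torus.IsSmoothSpaceTimeOn (Icc a b) (fun s y => Real.sin α • w₁ s y - -Real.cos α • w₂ s y) :=
    (hw₁.const_smul _).sub (hw₂.const_smul _)
  have hRq₁ : Torus.IsSmoothSpaceTimeOn (Icc a b) (fun s y => Real.cos α • q₁ s y - Real.sin α • q₂ s y) :=
    (hq₁.const_smul _).sub (hq₂.const_smul _)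
  have hRq₂ : Torus.IsSmoothSpaceTimeOn (Icc a b) (fun s y => Real.sin α • q₁ s y - -Real.cos α • q₂ s y) :=
    (hq₁.const_smul _).sub (hq₂.const_smul _)
  have hdivlin : ∀ (c₁ c₂ : ℝ), ∀ s ∈ Icc a b, Torus.IsDivFree (fun y => c₁ • w₁ s y - c₂ • w₂ s y) := by
    intro c₁ c₂ s hs y
    have e : (fun y => c₁ • w₁ s y - c₂ • w₂ s y) = c₁ • w₁ s - c₂ • w₂ s := rfl
    have h1 : Torus.IsContDiff 1 (c₁ • w₁ s) := ((hw₁.isSmooth_slice hs).smul c₁).isContDiff (by simp)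
    have h2 : Torus.IsContDiff 1 (c₂ • w₂ s) := ((hw₂.isSmooth_slice hs).smul c₂).isContDiff (by simp)
    rw [e, Torus.divergence_sub h1 h2,
      Torus.divergence_const_smul_of_isSmooth (hw₁.isSmooth_slice hs) c₁,
      Torus.divergence_const_smul_of_isSmooth (hw₂.isSmooth_slice hs) c₂,
      hwdiv₁ s hs y, hwdiv₂ s hs y, mul_zero, mul_zero, sub_zero]
  -- uniqueness: translate = rotated combination
  have e₁ := Torus.linearisedNS_unique hν hu hudiv hTs₁ hTq₁ hTdiv₁ hT₁ hRs₁ hRq₁ (hdivlin _ _) hR₁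
    (funext fun y => by simpa using h₁ y) ht
  have e₂ := Torus.linearisedNS_unique hν hu hudiv hTs₂ hTq₂ hTdiv₂ hT₂ hRs₂ hRq₂ (hdivlin _ _) hR₂
    (funext fun y => by simpa [sub_eq_add_neg] using h₂ y) ht
  refine ⟨by simpa using congrFun e₁ x, ?_⟩
  have := congrFun e₂ x
  simpa [sub_eq_add_neg] using this


/-- **Streamwise-invariant data stay streamwise invariant** (the case `α = 0`, one solution): along a
jointly smooth divergence-free background invariant under `x ↦ x + v`, a classical linearised solution
whose datum satisfies `w(a, x + v) = w(a, x)` satisfies `w(t, x + v) = w(t, x)` for all `t ∈ [a, b]`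
(the `k = 0` block; for PARALLEL such data the solution is the heat flow,
`Torus.linearisedNS_parallel_unique`). [cite: BedrossianCotiZelati2017, §1 Thm 1.1 (P_k decoupling, k = 0)] -/
theorem Torus.linearisedNS_translate_invariant (hν : 0 ≤ ν) (hab : a < b)
    (hu : Torus.IsSmoothSpaceTimeOn (Icc a b) u) (hudiv : ∀ t ∈ Icc a b, Torus.IsDivFree (u t))
    (v : UnitAddTorus d) (huv : ∀ t ∈ Icc a b, ∀ x, u t (x + v) = u t x)
    (hw₁ : Torus.IsSmoothSpaceTimeOn (Icc a b) w₁) (hq₁ : Torus.IsSmoothSpaceTimeOn (Icc a b) q₁)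
    (hwdiv₁ : ∀ t ∈ Icc a b, Torus.IsDivFree (w₁ t))
    (hlin₁ : ∀ t ∈ Icc a b, ∀ x, Torus.timeDerivWithin (Icc a b) w₁ t x + Torus.convect (u t) (w₁ t) x +
      Torus.convect (w₁ t) (u t) x = ν • Torus.laplacian (w₁ t) x - Torus.gradient (q₁ t) x)
    (h₁ : ∀ x, w₁ a (x + v) = w₁ a x) {t : ℝ} (ht : t ∈ Icc a b) (x : UnitAddTorus d) :
    w₁ t (x + v) = w₁ t x := by
  have h := (Torus.linearisedNS_streamwise_rotation_invariant hν hab hu hudiv v huv hw₁ hq₁ hwdiv₁ hlin₁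
    hw₁ hq₁ hwdiv₁ hlin₁ 0 (fun y => by simp [h₁ y]) (fun y => by simp [h₁ y]) ht x).1
  simpa using h

/-- **Axis form**: invariance under ALL translations along the `i`-th axis is preserved (apply
`Torus.linearisedNS_translate_invariant` with `v = Pi.single i s` for each `s`), e.g. for the cascade
carrier on a half-slot. [cite: BedrossianCotiZelati2017, §1 Thm 1.1 (P_k decoupling, k = 0)] -/
theorem Torus.linearisedNS_forall_add_single_invariant (hν : 0 ≤ ν) (hab : a < b) {i : d}
    (hu : Torus.IsSmoothSpaceTimeOn (Icc a b) u) (hudiv : ∀ t ∈ Icc a b, Torus.IsDivFree (u t))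
    (hinv : ∀ t ∈ Icc a b, ∀ (s : UnitAddCircle) (x : UnitAddTorus d), u t (x + Pi.single i s) = u t x)
    (hw₁ : Torus.IsSmoothSpaceTimeOn (Icc a b) w₁) (hq₁ : Torus.IsSmoothSpaceTimeOn (Icc a b) q₁)
    (hwdiv₁ : ∀ t ∈ Icc a b, Torus.IsDivFree (w₁ t))
    (hlin₁ : ∀ t ∈ Icc a b, ∀ x, Torus.timeDerivWithin (Icc a b) w₁ t x + Torus.convect (u t) (w₁ t) x +
      Torus.convect (w₁ t) (u t) x = ν • Torus.laplacian (w₁ t) x - Torus.gradient (q₁ t) x)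
    (h₁ : ∀ (s : UnitAddCircle) (x : UnitAddTorus d), w₁ a (x + Pi.single i s) = w₁ a x)
    {t : ℝ} (ht : t ∈ Icc a b) (s : UnitAddCircle) (x : UnitAddTorus d) :
    w₁ t (x + Pi.single i s) = w₁ t x :=
  Torus.linearisedNS_translate_invariant hν hab hu hudiv (Pi.single i s) (fun r hr y => hinv r hr s y)
    hw₁ hq₁ hwdiv₁ hlin₁ (h₁ s) ht x

end Modes

end Literature.Analysis.FluidPDE

end
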